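/-
Copyright (c) 2026 the pub-hodgecm-mathlib formalisation cell (harness21).  Prover seat hodgecm-mathlib-F0P2-p02 (g10): road «S3-tree» (LEAD F0P3a-plan (g11) WORD T10-2;
architect A-p16 (g29) A-63 (1)), brick T2-S, FILE 4d = THE APARTMENT IS CONNECTED (the subtree `Y` of the per-period fold); 2026-09-01.
-/
import Literature.NumberTheory.Automorphic.UnitaryLatticeTreeApartmentPath   -- ★ T2-S FILE 4b (F0P2-p02 (g10)) p845535: the apartment edges `L′_a — L_a — L′_{a+1}`
import Mathlib.Combinatorics.SimpleGraph.Connectivity.Connected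
import HarnessLib

/-!
# The apartment `{L_a} ∪ {L′_a}` of the split torus of `U(3)` induces a CONNECTED subgraph of the lattice graph (Serre, *Trees* I.6.4; Bruhat–Tits 1972 §10)

Topic `NumberTheory/Automorphic`; namespace `Literature.NumberTheory.Automorphic.UnitaryLatticeTree` (T1a's).  THEOREMS ONLY: no definition, no named fact, no instance, no
notation, no `sorry`.  Cell `pub/hodgecm-mathlib` (D-0151), crux H413 = `stmt-HodgeConjecture-24833`; road «S3-tree», brick **T2-S** (holder F0P2-p02 (g10)), FILE 4d: the set
`Y = {v | ∃ a, v.1 = L_a ∨ v.1 = L′_a}` of apartment vertices induces a connected subgraph of `latticeGraph σ ϖ J₀` — the «infinite subtree `Y`» input of ★ F0P3a-p08 (g17)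
`TreeHereditaryLayerCount` ∕ ★ `TreeRetraction.exists_retraction` (retraction onto `Y`) for T2-S's per-period tube fold (fundamental domain `{L_0, L′_1}` under `t_1`, ★ FILE 4c).
HONEST LABEL: HC_CM is proved only modulo the 2 remaining named inputs (hLiu418 24832, h413 24833) until rung 0 closes; nothing printed is asserted here.

* `reachable_induce_apartment_selfDual_two_succ` ∕ `…_two_selfDual`: the two edge types of ★ FILE 4b, read in the induced subgraph on `Y`;
* `reachable_induce_apartment_selfDual_selfDual_add_nat`: `L_a ⇝ L_{a+n}` inside `Y` (induction on `n`);
* **`connected_induce_apartment`**: `((latticeGraph σ ϖ J₀).induce Y).Connected`.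

## References
* [Serre1980Trees] J.-P. Serre, *Trees* (1980), Ch. I §6.4 (the axis of a hyperbolic automorphism is a doubly infinite path), Ch. II §1.1.
* [BruhatTits1972] F. Bruhat, J. Tits, *Groupes réductifs sur un corps local I*, Publ. Math. IHÉS 41 (1972), §10 (apartments).
-/

set_option autoImplicit false

noncomputable section

open scoped Valued WithZero Matrix MatrixGroups

namespace Literature.NumberTheory.Automorphic.UnitaryLatticeTree

open Literature.NumberTheory.Automorphic Literature.NumberTheory.Automorphic.HermitianLattice
open Literature.NumberTheory.Automorphic.CartanUnique (uniformizer_ne_zero)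

variable {K : Type*} [Field K] [Valued K ℤᵐ⁰] {σ : K →+* K} {ϖ : K}

/-- `|ϖ| ≤ 1` for a uniformiser (local copy of the one-liner, to keep imports light). [cite: Serre1980Trees, II.1.1] -/
private theorem v_le_one_aux (hϖ : Valued.v ϖ = WithZero.exp (-1 : ℤ)) : Valued.v ϖ ≤ 1 := by
  rw [hϖ, ← WithZero.exp_zero, WithZero.exp_le_exp]; norm_num

section
variable (σ ϖ)

/-- Membership of a vertex in the apartment `Y` of the frame `J₀` (a predicate on the underlying lattice; no definition is introduced — consumers take this `Set` literally).
[cite: BruhatTits1972, §10] -/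
theorem mem_apartment_iff (v : {M : Submodule 𝒪[K] (Fin 3 → K) // IsVertex σ ϖ ((StdForm.antidiagonal 3).over K) M}) :
    v ∈ {v : {M : Submodule 𝒪[K] (Fin 3 → K) // IsVertex σ ϖ ((StdForm.antidiagonal 3).over K) M} |
        ∃ a : ℤ, v.1 = latt (Matrix.diagonal ![ϖ ^ a, (1 : K), ϖ ^ (-a)]) ∨ v.1 = latt (Matrix.diagonal ![ϖ ^ a, (1 : K), ϖ ^ (1 - a)])} ↔
      ∃ a : ℤ, v.1 = latt (Matrix.diagonal ![ϖ ^ a, (1 : K), ϖ ^ (-a)]) ∨ v.1 = latt (Matrix.diagonal ![ϖ ^ a, (1 : K), ϖ ^ (1 - a)]) := Iff.rfl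

end

/-- **The apartment induces a connected subgraph**: with `Y = {v | ∃ a, v.1 = L_a ∨ v.1 = L′_a}`, `((latticeGraph σ ϖ J₀).induce Y).Connected` (`σ` an involution fixing the
uniformiser `ϖ`).  Every vertex of `Y` is joined to `L_0` inside `Y` along `… L_a — L′_{a+1} — L_{a+1} …` (★ FILE 4b edges). [cite: Serre1980Trees, I.6.4] [cite: BruhatTits1972, §10] -/
theorem connected_induce_apartment (hσ : ∀ x, σ (σ x) = x) (hσϖ : σ ϖ = ϖ) (hϖ : Valued.v ϖ = WithZero.exp (-1 : ℤ)) :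
    ((latticeGraph σ ϖ ((StdForm.antidiagonal 3).over K)).induce
      {v : {M : Submodule 𝒪[K] (Fin 3 → K) // IsVertex σ ϖ ((StdForm.antidiagonal 3).over K) M} |
        ∃ a : ℤ, v.1 = latt (Matrix.diagonal ![ϖ ^ a, (1 : K), ϖ ^ (-a)]) ∨ v.1 = latt (Matrix.diagonal ![ϖ ^ a, (1 : K), ϖ ^ (1 - a)])}).Connected := by
  -- abbreviations (local `let`s are avoided: we work with explicit terms)
  set G := latticeGraph σ ϖ ((StdForm.antidiagonal 3).over K) with hG
  set Y := {v : {M : Submodule 𝒪[K] (Fin 3 → K) // IsVertex σ ϖ ((StdForm.antidiagonal 3).over K) M} |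
        ∃ a : ℤ, v.1 = latt (Matrix.diagonal ![ϖ ^ a, (1 : K), ϖ ^ (-a)]) ∨ v.1 = latt (Matrix.diagonal ![ϖ ^ a, (1 : K), ϖ ^ (1 - a)])} with hY
  have hϖ1 := v_le_one_aux hϖ
  have hϖ0 := uniformizer_ne_zero hϖ
  -- the apartment vertices as elements of `Y`
  let vS : ℤ → Y := fun a => ⟨⟨latt (Matrix.diagonal ![ϖ ^ a, (1 : K), ϖ ^ (-a)]),
    ⟨0, isSelfDualLattice_latt_diagonal_zpow hσ hσϖ hϖ1 hϖ0 a⟩⟩, ⟨a, Or.inl rfl⟩⟩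
  let vT : ℤ → Y := fun a => ⟨⟨latt (Matrix.diagonal ![ϖ ^ a, (1 : K), ϖ ^ (1 - a)]),
    ⟨2, isVertexLattice_two_latt_diagonal_zpow hσ hσϖ hϖ1 hϖ0 a⟩⟩, ⟨a, Or.inr rfl⟩⟩
  -- the two edge types inside the induced graph
  have hTS : ∀ a : ℤ, (G.induce Y).Adj (vT a) (vS a) := fun a => by
    rw [SimpleGraph.induce_adj]
    exact latticeGraph_adj_apartment_two_selfDual hσ hσϖ hϖ a
  have hST : ∀ a : ℤ, (G.induce Y).Adj (vS a) (vT (a + 1)) := fun a => by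
    rw [SimpleGraph.induce_adj]
    exact latticeGraph_adj_apartment_selfDual_two_succ hσ hσϖ hϖ a
  -- `L_a ⇝ L_{a+n}`
  have hSS : ∀ (a : ℤ) (n : ℕ), (G.induce Y).Reachable (vS a) (vS (a + n)) := by
    intro a n
    induction n with
    | zero => rw [Nat.cast_zero, add_zero]
    | succ n ih =>
      refine ih.trans ?_
      rw [Nat.cast_succ, ← add_assoc]
      exact ((hST (a + n)).reachable).trans (hTS (a + n + 1)).reachable
  -- every apartment vertex reaches `L_0`
  have hS0 : ∀ a : ℤ, (G.induce Y).Reachable (vS a) (vS 0) := by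
    intro a
    rcases le_or_gt a 0 with ha | ha
    · have h := hSS a (-a).toNat
      rw [Int.toNat_of_nonneg (by omega), add_neg_cancel] at h
      exact h
    · have h := hSS 0 a.toNat
      rw [Int.toNat_of_nonneg (by omega), zero_add] at h
      exact h.symm
  have hT0 : ∀ a : ℤ, (G.induce Y).Reachable (vT a) (vS 0) := fun a => (hTS a).reachable.trans (hS0 a)
  -- assemble
  haveI : Nonempty Y := ⟨vS 0⟩
  refine SimpleGraph.Connected.mk fun x y => ?_
  have hx : (G.induce Y).Reachable x (vS 0) := by
    obtain ⟨⟨M, hM⟩, ⟨a, ha | ha⟩⟩ := x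
    · have : (⟨⟨M, hM⟩, ⟨a, Or.inl ha⟩⟩ : Y) = vS a := by
        apply Subtype.ext; apply Subtype.ext; exact ha
      rw [this]; exact hS0 a
    · have : (⟨⟨M, hM⟩, ⟨a, Or.inr ha⟩⟩ : Y) = vT a := by
        apply Subtype.ext; apply Subtype.ext; exact ha
      rw [this]; exact hT0 a
  have hy : (G.induce Y).Reachable y (vS 0) := by
    obtain ⟨⟨M, hM⟩, ⟨a, ha | ha⟩⟩ := y
    · have : (⟨⟨M, hM⟩, ⟨a, Or.inl ha⟩⟩ : Y) = vS a := by
        apply Subtype.ext; apply Subtype.ext; exact ha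
      rw [this]; exact hS0 a
    · have : (⟨⟨M, hM⟩, ⟨a, Or.inr ha⟩⟩ : Y) = vT a := by
        apply Subtype.ext; apply Subtype.ext; exact ha
      rw [this]; exact hT0 a
  exact hx.trans hy.symm

end Literature.NumberTheory.Automorphic.UnitaryLatticeTree

end
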